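import Summits.BirchSwinnertonDyer.Rank1Residual.X11b.BDPRouteWholeClassLarge
import HarnessLib

/-!
# Class X11b, route "BDP + converse-theorem engine + Kolyvagin": the whole-class theorem at EVERY ODD PRIME with the non-surjective corner localised (cell `b2b-bsdres`, sub-cell `multr1-p2`, gen 8 content re-landed in gen 9)

HONEST FRAMING (verbatim, cell `b2b-bsdres`): the goal of the cell is to DELETE the
COMBINATION-SHAPED residual classes for ALL analytic-rank `≤ 1` curves over `ℚ` — "full BSD
formula for every rank `≤ 1` curve in class `C`" assembled STRICTLY from published theorems — so
that the rank-`≤ 1` remainder becomes exactly the CONSTRUCTION-SHAPED classes, which are TYPED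
(missing-input Props), NOT attempted; this is not "finishing BSD". Research route `p2` for class
X11b; no claim beyond the stated class; nothing booked; X11b stays CONSTRUCTION-SHAPED. Theorems
only (no definition, no new named fact).

## What this file does

These two theorems were submitted by gen 8 as an APPEND to `BDPRouteWholeClassLarge.lean`
(proposal p210762, 2026-08-20T07:22Z) and sat unelaborated in the gate's per-target queue; they are
re-landed here VERBATIM in their own module (if p210762 is ever processed it bounces on the duplicate
names — nothing lands twice):

* `bsdp_of_classX11b_odd_of_typedInputs_local` — the whole-class theorem at EVERY odd prime (`p = 3`
  included) with the non-surjective corner (T4) LOCALISED to the decidable sub-population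
  `ClassX11b ∧ ¬Surj ∧ p ∣ ord_p Δ_min(E) ∧ ¬Ram` (`ClassX11b.dvd_and_not_ram_of_not_surj`: Silverman
  *ATAEC* V.6.1 at `ℓ = p` + Serre Prop. 15; no named fact, hence no `hBDMTV` and no `p ∈ {5,7}`
  clause);
* `missingLowerBoundAt_of_classX11b_of_not_dvd_odd` — at every odd `p` the lower half ⇐ STEP L with
  NO `Surj` hypothesis on the très-ramifié pairs (`p ∤ ord_p Δ_min`; `288` of the `628` in-window
  `p = 3` X11b-shape rows).

CONDITIONAL theorems (typed inputs OPEN); nothing booked; labels unchanged.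

## References

* [SilvermanATAEC1994] V.6 Prop. 6.1 (p. 410); [SerreInventiones1972] §2.4 Prop. 15; and the
  references of `BDPRouteWholeClassLarge.lean`.
-/

noncomputable section

open scoped Classical

open WeierstrassCurve NumberField Literature.NumberTheory.EllipticCurves
  Literature.NumberTheory.EllipticCurves.ModularForms
  Literature.NumberTheory.EllipticCurves.Rank1Residual
  Literature.NumberTheory.EllipticCurves.Rank1Residual.Typed
  Literature.NumberTheory.EllipticCurves.Wuthrich2014
  Literature.NumberTheory.EllipticCurves.BalakrishnanEtAl2019

namespace Summit.BirchSwinnertonDyer.Rank1Residual.X11b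

/-! ### Every odd prime (`p = 3` included): the non-surjective corner LOCALISED at `p ∣ ord_p Δ_min ∧ ¬Ram` -/

/-- **X11b, whole class, EVERY ODD PRIME (`p = 3` included), with (T4) localised.** `BSD(E,p)` for
every pair of X11b from eleven PUBLISHED facts and the typed inputs (T1) STEP L on the surjective
pairs, (T2′) the Euler-system half off the unconditional atom (ram) ∧ `p ∤ ∏c_ℓ`, and (T4″)
`Typed.MissingPPartAt` on the DECIDABLE sub-population `ClassX11b ∧ ¬Surj ∧ p ∣ ord_p Δ_min(E) ∧ ¬Ram`
(`ClassX11b.dvd_and_not_ram_of_not_surj`: Silverman *ATAEC* V.6.1 at `ℓ = p` + Serre Prop. 15; no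
named fact, so no `hBDMTV` here and no `p ∈ {5,7}` clause — at `p = 3` the image theorems of
Bilu–Parent–Rebolledo do not apply).  This refines (T4) of gen 7's
`bsdp_of_classX11b_odd_of_typedInputs`.  In the cell's window (`N < 2·10⁴`, hyp ledger) the
`p = 3` X11b-shape rows are `628`: `288` très ramifié (`3 ∤ ord_3 Δ_min`, all surjective — as the
theorem forces), `340` peu ramifié (`2` non-surjective).  CONDITIONAL; nothing booked; labels
unchanged. [cite: SilvermanATAEC1994, V.6 Prop. 6.1 (p. 410)] [cite: SerreInventiones1972, §2.4 Prop. 15]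
[cite: JetchevSkinnerWan2017, §7.4.1–7.4.3 (pp. 30–31)] [cite: Wuthrich2014, Prop. 21 (p. 400)]
[cite: Miller2011LMS, Def. 1.1] -/
theorem bsdp_of_classX11b_odd_of_typedInputs_local
    -- published inputs (named facts of the tree)
    (hGZ : ∀ (N : ℕ) [NeZero N] (W : WeierstrassCurve ℚ) (K : Type) [Field K] [NumberField K],
      gross_zagier N W K)
    (hKo : ∀ (N : ℕ) [NeZero N] (W : WeierstrassCurve ℚ) (K : Type) [Field K] [NumberField K],
      kolyvagin N W K)
    (hB : ∀ (N : ℕ) [NeZero N] (W : WeierstrassCurve ℚ) (K : Type) [Field K] [NumberField K],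
      Kolyvagin1990_padicValNat_card_sha_le N W K)
    (hSk : Skinner2016.thmC_padicValRat_bsd_rank_zero) (hWu : sha_dvd_analyticSha)
    (hGZK : rank_eq_analyticRank_of_analyticRank_le_one) (hmod : hasEntireLFunction_rat)
    (hnf : exists_isNewformOf) (hHL : HoffsteinLuo1997_exists_twist_L_one_ne_zero)
    (hMaz : mazur_not_dvd_maninConstant_of_odd) (hNS : integral_neronScaling_of_isGloballyMinimal)
    -- (T1) the typed input of the route (STEP L), at the odd-`d_K` Heegner data of surjective X11b pairs
    (hL : ∀ (W : WeierstrassCurve ℚ) [W.IsElliptic] [W.IsGloballyMinimal] (p : ℕ) [Fact p.Prime]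
      (N : ℕ) [NeZero N] (K : Type) [Field K] [NumberField K]
      (Dt : ModularParametrizationData W N) (H : HeegnerDatum N (NumberField.discr K)) (ι : K →+* ℂ)
      (P : (W.baseChange K).toAffine.Point),
      ClassX11b W p → Surj W p → W.conductorNorm ℤ = N → IsImaginaryQuadratic K →
      Odd (NumberField.discr K) → ¬ (p : ℤ) ∣ NumberField.discr K → ¬ p ∣ Units.torsionOrder K →
      SatisfiesHeegnerHypothesis N K →
      (W.quadraticTwist (NumberField.discr K : ℚ)).entireLFunction 1 ≠ 0 →
      WeierstrassCurve.Affine.Point.map ι.toRatAlgHom P = heegnerPointComplex Dt H →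
      ¬ (p : ℤ) ∣ Dt.c → IndexLowerBoundAt W p K P)
    -- (T2′) the Euler-system half off the unconditional atom (ram) ∧ `p ∤ ∏ c_ℓ`
    (hU : ∀ (W : WeierstrassCurve ℚ) [W.IsElliptic] [W.IsGloballyMinimal] (p : ℕ) [Fact p.Prime],
      ClassX11b W p → Surj W p → ¬ (Ram W p ∧ ¬ p ∣ W.tamagawaProduct) →
        Typed.MissingUpperBoundAt W p)
    -- (T4″) the non-surjective corner, LOCALISED: `p ∣ ord_p Δ_min`, no (ram) prime
    (hC : ∀ (W : WeierstrassCurve ℚ) [W.IsElliptic] [W.IsGloballyMinimal] (p : ℕ) [Fact p.Prime],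
      ClassX11b W p → ¬ Surj W p → p ∣ padicValInt p W.minimalDiscriminantInt → ¬ Ram W p →
        Typed.MissingPPartAt W p) :
    ∀ (W : WeierstrassCurve ℚ) [W.IsElliptic] [W.IsGloballyMinimal] (p : ℕ) [Fact p.Prime],
      ClassX11b W p → BSDp W p := by
  intro W _ _ p _ hX
  refine Typed.bsdp_of_missingPPartAt W p hGZK (by rw [hX.1]) ?_
  by_cases hs : Surj W p
  · refine Typed.missingPPartAt_of_lower_of_upper W p
      (missingLowerBoundAt_of_classX11b_of_surj_odd hGZ hKo hWu hGZK hmod hnf hHL hMaz hNS hL W p hX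
        hs) ?_
    by_cases hloc : Ram W p ∧ ¬ p ∣ W.tamagawaProduct
    · exact missingUpperBoundAt_of_classX11b_of_ram_of_not_dvd hGZ hKo hB hSk hGZK hmod hnf hHL hMaz
        hNS W p hX hloc.1 hloc.2
    · exact hU W p hX hs hloc
  · obtain ⟨hdvd, hnr⟩ := ClassX11b.dvd_and_not_ram_of_not_surj W p hX hs
    exact hC W p hX hs hdvd hnr

/-- **At every odd `p`, `Surj` is free on the très-ramifié X11b pairs**: the lower half of
`BSD(E,p)` follows from STEP L alone for an X11b pair with `p ∤ ord_p Δ_min(E)` (no `Surj`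
hypothesis: `ClassX11b.surj_of_not_dvd`), `p = 3` included — the `Surj W 3` binder of gen 6's
`missingLowerBoundAt_of_classX11b_of_surj_odd` / `IsX11Three.…_of_surj_…` is discharged on
`288` of the `628` in-window `p = 3` rows. CONDITIONAL on STEP L; nothing booked.
[cite: SilvermanATAEC1994, V.6 Prop. 6.1 (p. 410)] [cite: Wuthrich2014, Prop. 21 (p. 400)]
[cite: JetchevSkinnerWan2017, §7.4.1 (pp. 30–31)] -/
theorem missingLowerBoundAt_of_classX11b_of_not_dvd_odd
    (hGZ : ∀ (N : ℕ) [NeZero N] (W : WeierstrassCurve ℚ) (K : Type) [Field K] [NumberField K],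
      gross_zagier N W K)
    (hKo : ∀ (N : ℕ) [NeZero N] (W : WeierstrassCurve ℚ) (K : Type) [Field K] [NumberField K],
      kolyvagin N W K)
    (hWu : sha_dvd_analyticSha)
    (hGZK : rank_eq_analyticRank_of_analyticRank_le_one) (hmod : hasEntireLFunction_rat)
    (hnf : exists_isNewformOf) (hHL : HoffsteinLuo1997_exists_twist_L_one_ne_zero)
    (hMaz : mazur_not_dvd_maninConstant_of_odd) (hNS : integral_neronScaling_of_isGloballyMinimal)
    (hL : ∀ (W : WeierstrassCurve ℚ) [W.IsElliptic] [W.IsGloballyMinimal] (p : ℕ) [Fact p.Prime]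
      (N : ℕ) [NeZero N] (K : Type) [Field K] [NumberField K]
      (Dt : ModularParametrizationData W N) (H : HeegnerDatum N (NumberField.discr K)) (ι : K →+* ℂ)
      (P : (W.baseChange K).toAffine.Point),
      ClassX11b W p → Surj W p → W.conductorNorm ℤ = N → IsImaginaryQuadratic K →
      Odd (NumberField.discr K) → ¬ (p : ℤ) ∣ NumberField.discr K → ¬ p ∣ Units.torsionOrder K →
      SatisfiesHeegnerHypothesis N K →
      (W.quadraticTwist (NumberField.discr K : ℚ)).entireLFunction 1 ≠ 0 →
      WeierstrassCurve.Affine.Point.map ι.toRatAlgHom P = heegnerPointComplex Dt H →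
      ¬ (p : ℤ) ∣ Dt.c → IndexLowerBoundAt W p K P)
    (W : WeierstrassCurve ℚ) [W.IsElliptic] [W.IsGloballyMinimal] (p : ℕ) [Fact p.Prime]
    (hX : ClassX11b W p) (hΔ : ¬ p ∣ padicValInt p W.minimalDiscriminantInt) :
    Typed.MissingLowerBoundAt W p :=
  missingLowerBoundAt_of_classX11b_of_surj_odd hGZ hKo hWu hGZK hmod hnf hHL hMaz hNS hL W p hX
    (ClassX11b.surj_of_not_dvd W p hX hΔ)

end Summit.BirchSwinnertonDyer.Rank1Residual.X11b

end
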